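import Mathlib
import Summits.Ventures.PercRepro2.HCov
import Summits.Ventures.PercRepro2.RootLeafUCells
import Summits.Ventures.PercRepro2.RootLeafUAtoms1
import Summits.Ventures.PercRepro2.RootLeafUAtoms2
import Summits.Ventures.PercRepro2.RootLeafUAtoms3

set_option synthInstance.maxSize 2048

/-!
# The o-side split of the covariance form: `Gc = GcOL + GcOK` (blind cell PercRepro2, p4 g5;
proofs/P4-G5-STRUCTURE.md §6, the candidate strengthening (HALF) of (HCOV))

`Gc` is LINEAR in the o-row: each of its eight terms carries exactly one o-mass
(`Do, EQbo, EQb3o, EQo, EQ3o, PDbo`), the other two factors being o-free.  Restricting every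
o-mass to the configurations with `o ∈ C₁` (resp. `o ∈ C₂`) therefore splits the cubic form
into two halves, **`Gc = GcOL + GcOK`** (a polynomial identity in the 35 cells of the pattern of
`(o, a₂, a₃, b, a₁)`, RootLeafUCells with `u := a₁`):

  `GcOL = 2·D·Z·[P(T, oL, bL) − P(T, oL, bK)] + 2·D·gap·P(T, oL) + D·Z·[P(PD, oL, bL) − P(PD, oL, bK)]
          + D·gap·P(PD, oL) + (Z·EQb3 + gap·EQ3 + Z·PDb)·P(PD, oL) − Z·D·P(PD, oL, b ∈ U)`
  (`oL = {o ∈ C₁}`, `T = {a₃ ∈ C₂}`, `PD = {a₃ ∉ U}` on `Q`), i.e. `Z·E[1_Q 1_{o∈C₁} (D(σ_o − σ_c)(σ_b − E_μσ_b)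
  + 1_{PD}(Z·Cov_μ(σ_b,σ_c) + PDb − D·1_{b∈U}))]` cleared of denominators; `GcOK` is the root-mirror.

**(HALF)** `:= 0 ≤ GcOL ∧ 0 ≤ GcOK` is the candidate of record of proofs/P4-G5-STRUCTURE.md §6
(census: 8,945 / 8,945 two-root instances, n = 5–8, random and extreme weights; kit j245975);
`HCov_of_halves` records (HALF) ⟹ (HCOV).  In the `a₃`-isolated case `GcOL = −2Z²·Cov_μ(1_{oL}, 1_{bK})`,
BHK06 Thm 1.4 — (HALF) is the general form of that split.
-/
namespace Summit.Ventures.PercRepro2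

open UnionCluster CovForm RootLeafU

namespace OHalf

variable {V : Type*} {E : Type*} [Fintype E] [DecidableEq E] [Fintype V] [DecidableEq V]
  {R : Type*} [Field R] [LinearOrder R] [IsStrictOrderedRing R]

section Defs

variable (p : E → R) (ends : E → Sym2 V) (o a₁ a₂ a₃ b : V)

/-- **The `o ∈ C₁` half of `Gc`** (cleared; every o-mass of `Gc` restricted to `o ∈ C₁`). -/
noncomputable def GcOL : R :=
  2 * prob p (PDEvent ends a₁ a₂ a₃) * prob p (avoidAll ends a₂ {a₁}) * (prob p (TEvent ends a₁ a₂ a₃ ∩ (connEvent ends a₁ o ∩ connEvent ends a₁ b)) - prob p (TEvent ends a₁ a₂ a₃ ∩ (connEvent ends a₁ o ∩ connEvent ends a₂ b))) + 2 * prob p (PDEvent ends a₁ a₂ a₃) * gap p ends a₁ a₂ b * prob p (TEvent ends a₁ a₂ a₃ ∩ connEvent ends a₁ o) + prob p (PDEvent ends a₁ a₂ a₃) * prob p (avoidAll ends a₂ {a₁}) * (prob p (PDEvent ends a₁ a₂ a₃ ∩ (connEvent ends a₁ o ∩ connEvent ends a₁ b)) - prob p (PDEvent ends a₁ a₂ a₃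 ∩ (connEvent ends a₁ o ∩ connEvent ends a₂ b))) + prob p (PDEvent ends a₁ a₂ a₃) * gap p ends a₁ a₂ b * prob p (PDEvent ends a₁ a₂ a₃ ∩ connEvent ends a₁ o) + (prob p (avoidAll ends a₂ {a₁}) * EQb3 p ends a₁ a₂ a₃ b + gap p ends a₁ a₂ b * EQ3 p ends a₁ a₂ a₃ + prob p (avoidAll ends a₂ {a₁}) * PDb p ends a₁ a₂ a₃ b) * prob p (PDEvent ends a₁ a₂ a₃ ∩ connEvent ends a₁ o) - prob p (avoidAll ends a₂ {a₁}) * prob p (PDEvent ends a₁ a₂ a₃) * (prob p (PDEvent ends a₁ a₂ a₃ ∩ (connEvent ends a₁ o ∩ connEvent ends a₁ b)) + prob p (PDEvent ends a₁ a₂ a₃ ∩ (connEvent ends a₁ o ∩ connEvent ends a₂ b)))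

/-- **The `o ∈ C₂` half of `Gc`** (the root-mirror of `GcOL`). -/
noncomputable def GcOK : R :=
  -(2 * prob p (PDEvent ends a₁ a₂ a₃) * prob p (avoidAll ends a₂ {a₁}) * (prob p (TEvent ends a₂ a₁ a₃ ∩ (connEvent ends a₂ o ∩ connEvent ends a₁ b)) - prob p (TEvent ends a₂ a₁ a₃ ∩ (connEvent ends a₂ o ∩ connEvent ends a₂ b)))) - 2 * prob p (PDEvent ends a₁ a₂ a₃) * gap p ends a₁ a₂ b * prob p (TEvent ends a₂ a₁ a₃ ∩ connEvent ends a₂ o) - prob p (PDEvent ends a₁ a₂ a₃) * prob p (avoidAll ends a₂ {a₁}) * (prob p (PDEvent ends a₁ a₂ a₃ ∩ (connEvent ends a₂ o ∩ connEvent ends a₁ b)) - prob p (PDEvent ends a₁ a₂ a₃ ∩ (connEvent ends a₂ o ∩ connEvent ends a₂ b))) - prob p (PDEvent ends a₁ a₂ a₃) * gap p ends a₁ a₂ b * prob p (PDEvent ends a₁ a₂ a₃ ∩ connEvent ends a₂ o) + (prob p (avoidAll ends a₂ {a₁}) * EQb3 p ends a₁ a₂ a₃ b + gap p ends a₁ a₂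 b * EQ3 p ends a₁ a₂ a₃ + prob p (avoidAll ends a₂ {a₁}) * PDb p ends a₁ a₂ a₃ b) * prob p (PDEvent ends a₁ a₂ a₃ ∩ connEvent ends a₂ o) - prob p (avoidAll ends a₂ {a₁}) * prob p (PDEvent ends a₁ a₂ a₃) * (prob p (PDEvent ends a₁ a₂ a₃ ∩ (connEvent ends a₂ o ∩ connEvent ends a₁ b)) + prob p (PDEvent ends a₁ a₂ a₃ ∩ (connEvent ends a₂ o ∩ connEvent ends a₂ b)))

/-- **(HALF)**: both o-halves of the covariance form are non-negative (candidate, census 8,945 / 8,945). -/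
def HalfHCov : Prop := 0 ≤ GcOL p ends o a₁ a₂ a₃ b ∧ 0 ≤ GcOK p ends o a₁ a₂ a₃ b

end Defs

section Identity

variable (p : E → R) (ends : E → Sym2 V) (o a₁ a₂ a₃ b : V)

omit [LinearOrder R] [IsStrictOrderedRing R] in
set_option maxHeartbeats 4000000 in
/-- **The o-side split**: `Gc = GcOL + GcOK` — a polynomial identity in the 35 cells. -/
theorem Gc_eq_GcOL_add_GcOK :
    Gc p ends o a₁ a₂ a₃ b = GcOL p ends o a₁ a₂ a₃ b + GcOK p ends o a₁ a₂ a₃ b := by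
  unfold Gc GcOL GcOK DEF EQbo EQb3 EQb3o EQo EQ3 EQ3o PDb PDbo Do gap
  rw [cells_Q_uo_ub p ends o a₂ a₃ b a₁, cells_Q_ao_ab p ends o a₂ a₃ b a₁, cells_Q_ao_ub p ends o a₂ a₃ b a₁, cells_Q_uo_ab p ends o a₂ a₃ b a₁, cells_Tp_ub p ends o a₂ a₃ b a₁, cells_T_ab p ends o a₂ a₃ b a₁, cells_T_ub p ends o a₂ a₃ b a₁, cells_Tp_ab p ends o a₂ a₃ b a₁, cells_Tp_uo_ub p ends o a₂ a₃ b a₁, cells_Tp_ao_ub p ends o a₂ a₃ b a₁, cells_T_uo_ab p ends o a₂ a₃ b a₁, cells_T_ao_ab p ends o a₂ a₃ b a₁, cells_T_uo_ub p ends o a₂ a₃ b a₁, cells_T_ao_ub p ends o a₂ a₃ b a₁, cells_Tp_uo_ab p ends o a₂ a₃ b a₁, cells_Tp_ao_ab p ends o a₂ a₃ b a₁, cells_Q_uo p ends o a₂ a₃ b a₁, cells_Q_ao p ends o a₂ a₃ b a₁, cells_Tp p ends o a₂ a₃ b a₁, cells_T p ends o a₂ a₃ b a₁, cells_Tp_uo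 p ends o a₂ a₃ b a₁, cells_Tp_ao p ends o a₂ a₃ b a₁, cells_T_uo p ends o a₂ a₃ b a₁, cells_T_ao p ends o a₂ a₃ b a₁, cells_PD_ub p ends o a₂ a₃ b a₁, cells_PD_ab p ends o a₂ a₃ b a₁, cells_PD_uo_ub p ends o a₂ a₃ b a₁, cells_PD_ao_ub p ends o a₂ a₃ b a₁, cells_PD_uo_ab p ends o a₂ a₃ b a₁, cells_PD_ao_ab p ends o a₂ a₃ b a₁, cells_PD_uo p ends o a₂ a₃ b a₁, cells_PD_ao p ends o a₂ a₃ b a₁, cells_PD p ends o a₂ a₃ b a₁, cells_Q p ends o a₂ a₃ b a₁, cells_ub p ends o a₂ a₃ b a₁, cells_ab p ends o a₂ a₃ b a₁]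
  ring

/-- **(HALF) ⟹ (HCOV)**. -/
theorem HCov_of_halves (h : HalfHCov p ends o a₁ a₂ a₃ b) : HCov p ends o a₁ a₂ a₃ b := by
  unfold HCov
  rw [Gc_eq_GcOL_add_GcOK]
  exact add_nonneg h.1 h.2

end Identity

end OHalf

end Summit.Ventures.PercRepro2
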